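import Mathlib
import HarnessLib

/-!
# Clarke's generalised Jacobian, Clarke-regular points, and Lipschitz / Clarke-regular maps of manifolds read in charts

Topic `Geometry/Manifold`; namespace `Literature.Geometry.Manifold`. Statement-level (T0) vocabulary for the
*Lipschitz category between TOP and DIFF* and the one recognition theorem that turns a bi-Lipschitz
comparison map into a diffeomorphism:

* `clarkeJacobian f x` — Clarke's generalised Jacobian `∂f(x)` of a map `f : E → F` between real normed
  spaces: the convex hull of all limits `lim Df(xₖ)` along sequences `xₖ → x` of differentiability points
  (Clarke 1976, §1; Kondo–Tanaka 2017, (1.2)). For a locally Lipschitz map between finite-dimensional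
  spaces it is non-empty, compact and convex (Rademacher); for a `C¹` map it is `{Df(x)}`
  (`clarkeJacobian_eq_singleton`).
* `ClarkeRegularAt f x` — `x` is a NON-SINGULAR point of `f` in the sense of Clarke / Kondo–Tanaka
  Def. 1.5, equidimensional reading: `∂f(x)` is non-empty and consists of invertible continuous linear
  maps. (K–T ask "maximal rank"; for the equidimensional maps of Cor. 1.10 — the only use here — this is
  invertibility. Non-emptiness is part of the definition so that the predicate is not vacuously true for
  maps with no differentiability points near `x`; for locally Lipschitz maps of finite-dimensional spaces
  it is automatic.)
* `LocallyLipschitzInCharts I I' f`, `ClarkeRegularInCharts I I' f` — for a map `f : M → N` of charted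
  spaces: at every `x`, the map read in the preferred extended charts (`writtenInExtChartAt I I' x f`) is
  Lipschitz on a neighbourhood of `extChartAt I x x`, resp. Clarke-regular at that point. Intended for
  boundaryless models (`𝓡 n`), where both notions are independent of the `C¹`-compatible charts used
  (transition maps are local `C¹` diffeomorphisms; K–T §3, "the notion of the singular point of a
  Lipschitz map is independent of local charts"). A homeomorphism `h` of compact smooth manifolds with
  `h` and `h.symm` locally Lipschitz in charts is exactly a bi-Lipschitz homeomorphism for one
  (equivalently every) pair of smooth Riemannian distances.
* `KondoTanakaRecognition` — NAMED FACT (Kondo–Tanaka 2017, Cor. 1.10 of Thm. 1.3): a bi-Lipschitz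
  homeomorphism between compact smooth manifolds such that neither it nor its inverse has a Clarke-singular
  point implies the manifolds are diffeomorphic (mollification gives `C⁰`-close smooth immersions with
  Lipschitz control; an immersion `C⁰`-close to a homeomorphism of closed manifolds is a diffeomorphism).
  Stated chart-wise for manifolds modelled on `ℝⁿ`, universe `Type`, conclusion `Nonempty (M ≃ₘ⟮𝓡 n, 𝓡 n⟯ N)`.

Deliberately NOT here: Rademacher-based non-emptiness and compactness of `∂f(x)`, Clarke's inverse
function theorem (Clarke 1976, Thm. 1), the approximation theorem K–T Thm. 1.3 itself (needs immersions /
mapping degree), quasiconformal or Sobolev homeomorphisms, and K–T Cor. 1.15 (twisted spheres are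
bi-Lipschitz standard off one point).

## References

* F. H. Clarke, *On the inverse function theorem*, Pacific J. Math. 64 (1976) 97–102, §1 and Thm. 1 (bib: Clarke1976).
* K. Kondo, M. Tanaka, *Approximations of Lipschitz maps via immersions and differentiable exotic sphere
  theorems*, Nonlinear Anal. 155 (2017) 219–249 = arXiv:1408.6036, (1.2), Def. 1.5, Thm. 1.3, Cor. 1.10 (bib: KondoTanaka2017).
* S. K. Donaldson, D. P. Sullivan, *Quasiconformal 4-manifolds*, Acta Math. 163 (1989), Introduction
  (the Lipschitz pseudo-group and Lipschitz 4-manifolds; bib: DonaldsonSullivanActa1989).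
-/

noncomputable section

open scoped Manifold ContDiff Topology NNReal
open Set Function Filter

namespace Literature.Geometry.Manifold

section Clarke

variable {E : Type*} [NormedAddCommGroup E] [NormedSpace ℝ E]
  {F : Type*} [NormedAddCommGroup F] [NormedSpace ℝ F]

/-- The GENERATING SET of Clarke's generalised Jacobian of `f : E → F` at `x`: all limits
`A = lim Df(uₖ)` (operator-norm topology) along sequences `uₖ → x` of points where `f` is (Fréchet)
differentiable. Clarke 1976 §1 (there with an arbitrary null set of `uₖ` excluded, which does not change
the convex hull for locally Lipschitz maps of finite-dimensional spaces); Kondo–Tanaka 2017 (1.2).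
[cite: Clarke1976, §1] -/
def clarkeJacobianGen (f : E → F) (x : E) : Set (E →L[ℝ] F) :=
  {A | ∃ u : ℕ → E, Tendsto u atTop (𝓝 x) ∧ (∀ k, DifferentiableAt ℝ f (u k)) ∧
    Tendsto (fun k => fderiv ℝ f (u k)) atTop (𝓝 A)}

/-- **Clarke's generalised Jacobian** `∂f(x)` of `f : E → F` at `x`: the convex hull of the limits of
derivatives `lim Df(uₖ)` along sequences of differentiability points `uₖ → x` (`clarkeJacobianGen`).
Clarke, Pacific J. Math. 64 (1976), §1 ("generalized Jacobian"); Kondo–Tanaka 2017, (1.2)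
("generalized differential"). For `f` locally Lipschitz between finite-dimensional spaces it is a
non-empty compact convex set of linear maps; for `f` of class `C¹` near `x` it is `{Df(x)}`
(`clarkeJacobian_eq_singleton`). [cite: Clarke1976, §1] -/
def clarkeJacobian (f : E → F) (x : E) : Set (E →L[ℝ] F) :=
  convexHull ℝ (clarkeJacobianGen f x)

/-- **Clarke-regular (non-singular) point**, equidimensional reading of Kondo–Tanaka 2017 Def. 1.5
(after Clarke 1976, "∂f(x) of maximal rank"): the generalised Jacobian `∂f(x)` is non-empty and every
element of it is an invertible continuous linear map (`ContinuousLinearMap.IsInvertible`). A point that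
is not Clarke-regular is a SINGULAR point of `f`. Non-emptiness is built in to exclude the vacuous case
(no differentiability points near `x`); it is automatic for locally Lipschitz maps of finite-dimensional
spaces (Rademacher). [cite: KondoTanaka2017, Definition 1.5] -/
def ClarkeRegularAt (f : E → F) (x : E) : Prop :=
  (clarkeJacobian f x).Nonempty ∧ ∀ A ∈ clarkeJacobian f x, (A : E →L[ℝ] F).IsInvertible

variable {f : E → F} {x : E}

/-- The generating set is contained in the generalised Jacobian. [folklore] -/
theorem clarkeJacobianGen_subset_clarkeJacobian : clarkeJacobianGen f x ⊆ clarkeJacobian f x :=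
  subset_convexHull ℝ _

/-- The generalised Jacobian is convex. [folklore] -/
theorem convex_clarkeJacobian : Convex ℝ (clarkeJacobian f x) :=
  convex_convexHull ℝ _

/-- If `f` is differentiable at `x`, then `Df(x) ∈ ∂f(x)` (constant sequence). [folklore] -/
theorem fderiv_mem_clarkeJacobian (hf : DifferentiableAt ℝ f x) :
    fderiv ℝ f x ∈ clarkeJacobian f x :=
  clarkeJacobianGen_subset_clarkeJacobian
    ⟨fun _ => x, tendsto_const_nhds, fun _ => hf, tendsto_const_nhds⟩

/-- For a map of class `C¹` near `x`, the generating set of the generalised Jacobian is `{Df(x)}`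
(continuity of `Df`). [folklore] -/
theorem clarkeJacobianGen_eq_singleton (hf : ContDiffAt ℝ 1 f x) :
    clarkeJacobianGen f x = {fderiv ℝ f x} := by
  apply Subset.antisymm
  · rintro A ⟨u, hu, -, hA⟩
    have hcont : ContinuousAt (fderiv ℝ f) x := hf.continuousAt_fderiv one_ne_zero
    have h2 : Tendsto (fun k => fderiv ℝ f (u k)) atTop (𝓝 (fderiv ℝ f x)) := hcont.tendsto.comp hu
    exact mem_singleton_iff.2 (tendsto_nhds_unique hA h2)
  · rintro A rfl
    exact ⟨fun _ => x, tendsto_const_nhds, fun _ => hf.differentiableAt one_ne_zero, tendsto_const_nhds⟩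

/-- **`∂f(x) = {Df(x)}` for `C¹` maps** (Clarke 1976, §1, Remark: the generalised Jacobian reduces to
the usual one when `f` is `C¹`). [cite: Clarke1976, §1] -/
theorem clarkeJacobian_eq_singleton (hf : ContDiffAt ℝ 1 f x) :
    clarkeJacobian f x = {fderiv ℝ f x} := by
  rw [clarkeJacobian, clarkeJacobianGen_eq_singleton hf, convexHull_singleton]

/-- A `C¹` map with invertible derivative at `x` is Clarke-regular at `x`. [folklore] -/
theorem clarkeRegularAt_of_contDiffAt (hf : ContDiffAt ℝ 1 f x)
    (hA : (fderiv ℝ f x).IsInvertible) : ClarkeRegularAt f x := by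
  refine ⟨?_, fun A hA' => ?_⟩
  · rw [clarkeJacobian_eq_singleton hf]; exact singleton_nonempty _
  · rw [clarkeJacobian_eq_singleton hf, mem_singleton_iff] at hA'
    rw [hA']; exact hA

end Clarke

section Charts

variable {E : Type*} [NormedAddCommGroup E] [NormedSpace ℝ E] {H : Type*} [TopologicalSpace H]
  (I : ModelWithCorners ℝ E H)
  {E' : Type*} [NormedAddCommGroup E'] [NormedSpace ℝ E'] {H' : Type*} [TopologicalSpace H']
  (I' : ModelWithCorners ℝ E' H')
  {M : Type*} [TopologicalSpace M] [ChartedSpace H M]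
  {N : Type*} [TopologicalSpace N] [ChartedSpace H' N]

/-- **Locally Lipschitz in charts.** `f : M → N` is locally Lipschitz read in the preferred extended
charts: for every `x : M` there are `L` and a neighbourhood `s` of `extChartAt I x x` in the model vector
space on which `writtenInExtChartAt I I' x f = extChartAt I' (f x) ∘ f ∘ (extChartAt I x).symm` is
`L`-Lipschitz. Intended for boundaryless models (for models with boundary read `s` inside `range I`).
For `C¹`-compatible atlases the notion does not depend on the charts (transition maps are local `C¹`
diffeomorphisms, hence locally bi-Lipschitz); a homeomorphism `h` of compact smooth manifolds with `h`
and `h.symm` locally Lipschitz in charts is a bi-Lipschitz homeomorphism for any smooth Riemannian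
distances (the Lipschitz pseudo-group of Donaldson–Sullivan 1989, Introduction).
[cite: DonaldsonSullivanActa1989, Introduction] -/
def LocallyLipschitzInCharts (f : M → N) : Prop :=
  ∀ x : M, ∃ (L : ℝ≥0) (s : Set E), s ∈ 𝓝 (extChartAt I x x) ∧
    LipschitzOnWith L (writtenInExtChartAt I I' x f) s

/-- **No Clarke-singular point** ("`F` has no singular points on `M`", Kondo–Tanaka 2017 Def. 1.5 and
Cor. 1.10): for every `x : M` the map read in the preferred extended charts at `x` is Clarke-regular
(`ClarkeRegularAt`) at `extChartAt I x x`. Independent of the `C¹`-compatible charts used (K–T §3: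
generalised differentials transform by conjugation with the derivatives of the transition maps).
[cite: KondoTanaka2017, Definition 1.5] -/
def ClarkeRegularInCharts (f : M → N) : Prop :=
  ∀ x : M, ClarkeRegularAt (writtenInExtChartAt I I' x f) (extChartAt I x x)

end Charts

/-- **Kondo–Tanaka recognition theorem** (NAMED FACT; Kondo–Tanaka, Nonlinear Anal. 155 (2017),
Cor. 1.10 of Thm. 1.3): *let `F` be a bi-Lipschitz homeomorphism from a compact Riemannian manifold `M`
onto a Riemannian manifold `N`; if `F` and `F⁻¹` have no singular points (in the sense of Clarke) on `M`
and `N` respectively, then `M` and `N` are diffeomorphic.* Printed proof: Thm. 1.3 gives smooth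
immersions `f_η : M → N`, `g_η : N → M` uniformly `η`-close to `F`, `F⁻¹` with `L(f_η) ≤ L(F)(1+η)`;
then `g_η ∘ f_η` is `C⁰`-close to `id_M`, hence a diffeomorphism for small `η` (Lemma 2.x), so `f_η` is
an injective immersion of closed manifolds of the same dimension, i.e. a diffeomorphism.
Chart-wise transcription (see the module docstring for why it is faithful): `M`, `N` compact Hausdorff
second-countable `C^∞` manifolds modelled on `ℝⁿ` (universe `Type`), `h : M ≃ₜ N` with `h` and `h.symm`
locally Lipschitz in charts (`LocallyLipschitzInCharts`) and without Clarke-singular points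
(`ClarkeRegularInCharts`); conclusion `Nonempty (M ≃ₘ⟮𝓡 n, 𝓡 n⟯ N)`. Used as a hypothesis
`(h : KondoTanakaRecognition)`; discharging it needs mollification on manifolds and the
immersion/degree argument, neither in Mathlib. [cite: KondoTanaka2017, Corollary 1.10] -/
def KondoTanakaRecognition : Prop :=
  ∀ (n : ℕ) (M : Type) [TopologicalSpace M] [T2Space M] [SecondCountableTopology M] [CompactSpace M]
    [ChartedSpace (EuclideanSpace ℝ (Fin n)) M] [IsManifold (𝓡 n) ∞ M]
    (N : Type) [TopologicalSpace N] [T2Space N] [SecondCountableTopology N]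
    [ChartedSpace (EuclideanSpace ℝ (Fin n)) N] [IsManifold (𝓡 n) ∞ N]
    (h : M ≃ₜ N),
    LocallyLipschitzInCharts (𝓡 n) (𝓡 n) h → LocallyLipschitzInCharts (𝓡 n) (𝓡 n) h.symm →
    ClarkeRegularInCharts (𝓡 n) (𝓡 n) h → ClarkeRegularInCharts (𝓡 n) (𝓡 n) h.symm →
    Nonempty (M ≃ₘ⟮𝓡 n, 𝓡 n⟯ N)

end Literature.Geometry.Manifold

end
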